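import Mathlib
import HarnessLib
import Summits.HubbardSuperconductivity.HubbardSuperconductivity.Theorems.KLProgrammeKLRegimeKernelNormsLevelsDefs

/-!
# Route `KLProgramme` — ENGINE child gen 8 (stmt-HubbardSuperconductivity-20437 `KLRegimeEngineV17F2`), SKELETON v2 class #3, PROVING side:
# the LEVELS of the E.5 witness's prescriptions (`levelCount` / `levelGainExp` of the value-form `hNa`/`hNb` patterns)
# (cell gate-hubbard-kl, seat p5 g8; currency-independent bookkeeping for the derivation «carrier levelled norms ⇒ hNa/hNb» of memo §12/§17)

The hybrid tails (`…EngineV8E5BlockHybridTails`, `…Scaled`) read the carrier's levelled norms at two prescription patterns of a `k + q`-leg kernel: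
«contracted legs free, the `q` outputs prescribed» (`Fin.append (fun _ : Fin k => none) (some ∘ σ)`) and «line-`0` leg + two explicit contracted sectors + the
`q` outputs prescribed» (`Fin.append (fun i : Fin k => if (i:ℕ) < 3 then some (…) else none) (some ∘ σ)`).  Their levels (number of prescribed legs) and the
table's gain exponents `levelGainExp = min ((F−1)/2) 2`:

* `levelCount_append_none_some` : `= q`; `levelCount_append_dite_some` : `= 3 + q` (`3 ≤ k`);
* `levelGainExp_one = 0`, `levelGainExp_two = 0`, `levelGainExp_three = 1`, `levelGainExp_four = 1` (`levelGainExp_eq_two` for `F ≥ 5` is landed) — so, per colouring class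
  `(a, 4−a)` of the four output legs (memo §12): `a` outputs from copy `0` read gain exponent `levelGainExp a`, copy `1` reads `levelGainExp (3 + (4−a)) = 2`
  for `a ≤ 2`, `= 2`/`1` for `a = 3`/`a = 4`... exactly the table of memo §12 (total gain exponent `2` in every class).

Pure `Finset.card` bookkeeping; no definitions, no named facts, nothing about the model; nothing asserts superconductivity.
-/

noncomputable section

namespace Summit.HubbardSuperconductivity.HubbardSuperconductivity.Theorems.KLRegimeSplit

set_option linter.dupNamespace false -- summit = problem name (single-conjunct summit), D-0017

open Finset Literature.MathematicalPhysics.QuantumLattice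

section Levels

variable {N : ℕ}

/-- **«contracted legs free, outputs prescribed» has level `q`.** [folklore] -/
theorem levelCount_append_none_some (k q : ℕ) (σ : Fin q → SectorLeg N) :
    levelCount (Fin.append (fun _ : Fin k => (none : Option (SectorLeg N))) (fun j => some (σ j))) = q := by
  classical
  unfold levelCount
  have h : (univ.filter fun i : Fin (k + q) =>
      (Fin.append (fun _ : Fin k => (none : Option (SectorLeg N))) (fun j => some (σ j)) i).isSome) = (univ : Finset (Fin q)).map (Fin.natAddEmb k) := by
    ext i
    simp only [mem_filter, mem_univ, true_and, mem_map, Fin.natAddEmb_apply]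
    constructor
    · intro hi
      induction i using Fin.addCases with
      | left i => simp [Fin.append_left] at hi
      | right j => exact ⟨j, rfl⟩
    · rintro ⟨j, rfl⟩
      simp [Fin.append_right]
  rw [h, card_map, card_univ, Fintype.card_fin]

/-- **«line-`0` leg + two explicit contracted sectors + outputs prescribed» has level `3 + q`** (`3 ≤ k`). [folklore] -/
theorem levelCount_append_dite_some {k : ℕ} (hk : 3 ≤ k) (q : ℕ) (τ : Fin 3 → SectorLeg N) (σ : Fin q → SectorLeg N) :
    levelCount (Fin.append (fun i : Fin k => if h : (i : ℕ) < 3 then some (τ ⟨i, h⟩) else none) (fun j => some (σ j))) = 3 + q := by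
  classical
  unfold levelCount
  have h : (univ.filter fun i : Fin (k + q) =>
      (Fin.append (fun i : Fin k => if h : (i : ℕ) < 3 then some (τ ⟨i, h⟩) else none) (fun j => some (σ j)) i).isSome) =
      ((univ : Finset (Fin 3)).map ((Fin.castLEEmb hk).trans (Fin.castAddEmb q))) ∪ (univ : Finset (Fin q)).map (Fin.natAddEmb k) := by
    ext i
    simp only [mem_filter, mem_univ, true_and, mem_union, mem_map, Function.Embedding.trans_apply, Fin.castAddEmb_apply, Fin.natAddEmb_apply]
    constructor
    · intro hi
      induction i using Fin.addCases with
      | left i =>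
        rw [Fin.append_left] at hi
        by_cases h3 : (i : ℕ) < 3
        · left
          refine ⟨⟨i, h3⟩, ?_⟩
          ext; simp [Fin.castLEEmb]
        · rw [dif_neg h3] at hi; simp at hi
      | right j => exact Or.inr ⟨j, rfl⟩
    · rintro (⟨j, hj⟩ | ⟨j, rfl⟩)
      · rw [← hj, Fin.append_left]
        have : ((Fin.castLEEmb hk j : Fin k) : ℕ) < 3 := by simp [Fin.castLEEmb]
        rw [dif_pos this]; rfl
      · simp [Fin.append_right]
  rw [h, card_union_of_disjoint, card_map, card_map, card_univ, card_univ, Fintype.card_fin, Fintype.card_fin]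
  rw [disjoint_left]
  rintro i hi hi'
  obtain ⟨j, -, rfl⟩ := mem_map.1 hi
  obtain ⟨j', -, hj'⟩ := mem_map.1 hi'
  have h1 : (((Fin.castLEEmb hk).trans (Fin.castAddEmb q) j : Fin (k + q)) : ℕ) < k := by
    simp [Fin.castLEEmb]; omega
  have h2 : k ≤ ((Fin.natAddEmb k j' : Fin (k + q)) : ℕ) := by simp
  rw [hj'] at h2
  omega

/-- Gain exponents of the small levels: `levelGainExp 1 = 0`. [folklore] -/
theorem levelGainExp_one : levelGainExp 1 = 0 := by decide
/-- `levelGainExp 2 = 0`. [folklore] -/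
theorem levelGainExp_two : levelGainExp 2 = 0 := by decide
/-- `levelGainExp 3 = 1`. [folklore] -/
theorem levelGainExp_three : levelGainExp 3 = 1 := by decide
/-- `levelGainExp 4 = 1`. [folklore] -/
theorem levelGainExp_four : levelGainExp 4 = 1 := by decide
/-- **The E.5 colouring classes all carry total gain exponent `2`** (memo §12): with `a + b = 4` output legs (`a` from the copy read at «outputs
prescribed», `b` from the copy read at «3 explicit + outputs prescribed»), `levelGainExp a + levelGainExp (3 + b) ≥ 2`. [folklore] -/
theorem two_le_levelGainExp_add {a b : ℕ} (hab : a + b = 4) : 2 ≤ levelGainExp a + levelGainExp (3 + b) := by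
  unfold levelGainExp
  omega

end Levels

end Summit.HubbardSuperconductivity.HubbardSuperconductivity.Theorems.KLRegimeSplit

end
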